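import Literature.Computability.AlgebraicComplexity.PermanentIrreducible
import Mathlib.GroupTheory.Perm.DomMulAct
import Mathlib.RingTheory.MvPolynomial.Homogeneous
import Mathlib.Data.Nat.Choose.Basic
import Mathlib.Data.Real.Basic

/-!
# Crux `DetQP.DetqpThesis` (stmt-ValiantsHypothesis-0315) — line `one-cut-strength`,
# stub `stub_monotoneCalibration`: the MONOTONE one-cut strength of the permanent is `C(n, a)`

Registered stub S3 of `Cruxes/DetqpThesis/Lines/one_cut_strength.lean` (wall-breaker strategist line;
calibration, NOT load-bearing), proved VERBATIM:

> a CANCELLATION-FREE `(a, n-a)`-decomposition of the real permanent, `per_n = Σ_{k<r} g_k · h_k` with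
> `g_k` homogeneous of degree `a`, `h_k` homogeneous of degree `n - a` and ALL coefficients of all `g_k`,
> `h_k` nonnegative, has at least `C(n, a)` terms.

(Laplace expansion along `a` rows attains the bound, so the monotone one-cut strength is exactly
`C(n,a)`; with `C(2m, m) ≥ 2^m` the line's bet `OneCutStrengthNotQP` HOLDS in the monotone world —
`monotoneBet` in the line file.)

## Proof

Without cancellations every coefficient of every `g_k · h_k`, and every product of a monomial of `g_k`
with a monomial of `h_k`, survives in `per_n`; so all these products are permutation monomials.
For each permutation `ρ` pick a term `k(ρ)` and a splitting `μ_ρ = d₁ + d₂` with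
`coeff_{d₁} g_{k(ρ)} > 0`, `coeff_{d₂} h_{k(ρ)} > 0` (`exists_split_of_coeff_sum_mul_pos`); `d₁ ≤ μ_ρ`
is the sub-permutation monomial of `ρ` on a column set `S_ρ` (`|S_ρ| = a` by homogeneity). If
`k(ρ) = k(ρ')`, the cross product `d₁(ρ) + d₂(ρ')` is again a permutation monomial, and comparing
column and row counts (`colCount`, `rowCount` of `PermanentIrreducible.lean`) gives `S_ρ = S_{ρ'}`
and `ρ(S_ρ) = ρ'(S_{ρ'})`. Hence `ρ ↦ ρ₀⁻¹ ρ` maps the fibre of `k` injectively into the set-stabiliser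
of `S_{ρ₀}` in `𝔖_n`, of cardinality `a! (n-a)!` (`DomMulAct.stabilizer_card`), and
`n! = Σ_k |fibre_k| ≤ r · a! (n-a)!`, i.e. `C(n,a) ≤ r`.

Honest framing: a calibration of the one-cut-strength line in the monotone (cancellation-free) world;
the crux `DetqpThesis` (`dc(per_n)` not quasi-polynomially bounded) and the line's bet are OPEN;
nothing here bears on `VP ≠ VNP`.
-/

-- Sub = Summit layout duplicates the namespace component
set_option linter.dupNamespace false

noncomputable section

namespace Summit.ValiantsHypothesis.ValiantsHypothesis.Theorems.DetqpThesis.OneCutStrength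

open MvPolynomial Finset Literature.Computability.AlgebraicComplexity

/-! ### §1 Sub-permutation monomials: exponent vectors below a permutation monomial -/

section SubPerm

variable {ι : Type*} [Fintype ι] [DecidableEq ι]

/-- An exponent vector below `μ_ρ` vanishes off the graph cells `(ρ c, c)`. [folklore] -/
theorem apply_eq_zero_of_le_permMonomial {ρ : Equiv.Perm ι} {d : (ι × ι) →₀ ℕ}
    (hd : d ≤ permMonomial ρ) {r c : ι} (h : ρ c ≠ r) : d (r, c) = 0 := by
  have h1 := hd (r, c)
  rw [permMonomial_apply, if_neg h] at h1
  exact Nat.le_zero.1 h1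

/-- An exponent vector below `μ_ρ` has entries `0` or `1` on the graph cells. [folklore] -/
theorem apply_graph_eq_of_le_permMonomial {ρ : Equiv.Perm ι} {d : (ι × ι) →₀ ℕ}
    (hd : d ≤ permMonomial ρ) (c : ι) : d (ρ c, c) = if d (ρ c, c) ≠ 0 then 1 else 0 := by
  have h1 := hd (ρ c, c)
  rw [permMonomial_apply, if_pos rfl] at h1
  split_ifs with h
  · omega
  · simpa using h

/-- Column counts below `μ_ρ`: column `c` carries `[d (ρ c, c) ≠ 0]`. [folklore] -/
theorem colCount_of_le_permMonomial {ρ : Equiv.Perm ι} {d : (ι × ι) →₀ ℕ}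
    (hd : d ≤ permMonomial ρ) (c : ι) : colCount d c = if d (ρ c, c) ≠ 0 then 1 else 0 := by
  unfold colCount
  rw [Finset.sum_eq_single (ρ c)]
  · exact apply_graph_eq_of_le_permMonomial hd c
  · intro r _ hr
    exact apply_eq_zero_of_le_permMonomial hd (Ne.symm hr)
  · intro h; exact absurd (Finset.mem_univ _) h

/-- Row counts below `μ_ρ`: row `r` carries `[d (r, ρ⁻¹ r) ≠ 0]`. [folklore] -/
theorem rowCount_of_le_permMonomial {ρ : Equiv.Perm ι} {d : (ι × ι) →₀ ℕ}
    (hd : d ≤ permMonomial ρ) (r : ι) : rowCount d r = if d (r, ρ.symm r) ≠ 0 then 1 else 0 := by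
  unfold rowCount
  rw [Finset.sum_eq_single (ρ.symm r)]
  · have h := apply_graph_eq_of_le_permMonomial hd (ρ.symm r)
    rwa [Equiv.apply_symm_apply] at h
  · intro c _ hc
    refine apply_eq_zero_of_le_permMonomial hd fun h => hc ?_
    rw [← h, Equiv.symm_apply_apply]
  · intro h; exact absurd (Finset.mem_univ _) h

/-- Column counts of the complement `μ_ρ - d`. [folklore] -/
theorem colCount_permMonomial_sub {ρ : Equiv.Perm ι} {d : (ι × ι) →₀ ℕ}
    (hd : d ≤ permMonomial ρ) (c : ι) :
    colCount (permMonomial ρ - d) c = if d (ρ c, c) ≠ 0 then 0 else 1 := by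
  have h := colCount_add d (permMonomial ρ - d) c
  rw [add_tsub_cancel_of_le hd, colCount_permMonomial, colCount_of_le_permMonomial hd] at h
  split_ifs at h ⊢ <;> omega

/-- Row counts of the complement `μ_ρ - d`. [folklore] -/
theorem rowCount_permMonomial_sub {ρ : Equiv.Perm ι} {d : (ι × ι) →₀ ℕ}
    (hd : d ≤ permMonomial ρ) (r : ι) :
    rowCount (permMonomial ρ - d) r = if d (r, ρ.symm r) ≠ 0 then 0 else 1 := by
  have h := rowCount_add d (permMonomial ρ - d) r
  rw [add_tsub_cancel_of_le hd, rowCount_permMonomial, rowCount_of_le_permMonomial hd] at h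
  split_ifs at h ⊢ <;> omega

omit [DecidableEq ι] in
/-- The degree of an exponent vector is the sum of its column counts. [folklore] -/
theorem degree_eq_sum_colCount (d : (ι × ι) →₀ ℕ) : d.degree = ∑ c, colCount d c := by
  rw [Finsupp.degree_eq_sum, Fintype.sum_prod_type, Finset.sum_comm]
  rfl

/-- The column set of an exponent vector below `μ_ρ` has cardinality its degree. [folklore] -/
theorem card_colSet_of_le_permMonomial {ρ : Equiv.Perm ι} {d : (ι × ι) →₀ ℕ}
    (hd : d ≤ permMonomial ρ) :
    (Finset.univ.filter fun c => d (ρ c, c) ≠ 0).card = d.degree := by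
  rw [degree_eq_sum_colCount, Finset.card_filter]
  exact Finset.sum_congr rfl fun c _ => (colCount_of_le_permMonomial hd c).symm

/-- **Column comparison.** If `d ≤ μ_ρ`, `d' ≤ μ_{ρ'}` and the cross sum `d + (μ_{ρ'} - d')` is a
permutation monomial, then `d` and `d'` use the same columns. [folklore] -/
theorem col_iff_of_cross {ρ ρ' τ : Equiv.Perm ι} {d d' : (ι × ι) →₀ ℕ}
    (hd : d ≤ permMonomial ρ) (hd' : d' ≤ permMonomial ρ')
    (hτ : d + (permMonomial ρ' - d') = permMonomial τ) (c : ι) :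
    d (ρ c, c) ≠ 0 ↔ d' (ρ' c, c) ≠ 0 := by
  have h := colCount_add d (permMonomial ρ' - d') c
  rw [hτ, colCount_permMonomial, colCount_of_le_permMonomial hd,
    colCount_permMonomial_sub hd'] at h
  split_ifs at h with h1 h2 h2 <;> simp_all

/-- **Row comparison.** In the same situation `d` and `d'` use the same rows. [folklore] -/
theorem row_iff_of_cross {ρ ρ' τ : Equiv.Perm ι} {d d' : (ι × ι) →₀ ℕ}
    (hd : d ≤ permMonomial ρ) (hd' : d' ≤ permMonomial ρ')
    (hτ : d + (permMonomial ρ' - d') = permMonomial τ) (r : ι) :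
    d (r, ρ.symm r) ≠ 0 ↔ d' (r, ρ'.symm r) ≠ 0 := by
  have h := rowCount_add d (permMonomial ρ' - d') r
  rw [hτ, rowCount_permMonomial, rowCount_of_le_permMonomial hd,
    rowCount_permMonomial_sub hd'] at h
  split_ifs at h with h1 h2 h2 <;> simp_all

end SubPerm

/-! ### §2 Cancellation-free products -/

section Monotone

variable {σ : Type*}

/-- A product of polynomials with nonnegative real coefficients has nonnegative coefficients. [folklore] -/
theorem coeff_mul_nonneg {g h : MvPolynomial σ ℝ} (hg : ∀ d, 0 ≤ coeff d g) (hh : ∀ d, 0 ≤ coeff d h)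
    (e : σ →₀ ℕ) : 0 ≤ coeff e (g * h) := by
  classical
  rw [coeff_mul]
  exact Finset.sum_nonneg fun x _ => mul_nonneg (hg x.1) (hh x.2)

/-- No cancellation: the product of the `d₁`-coefficient of `g` and the `d₂`-coefficient of `h` is at
most the `(d₁ + d₂)`-coefficient of `g · h`. [folklore] -/
theorem coeff_mul_coeff_le_coeff_mul {g h : MvPolynomial σ ℝ} (hg : ∀ d, 0 ≤ coeff d g)
    (hh : ∀ d, 0 ≤ coeff d h) (d₁ d₂ : σ →₀ ℕ) :
    coeff d₁ g * coeff d₂ h ≤ coeff (d₁ + d₂) (g * h) := by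
  classical
  rw [coeff_mul]
  have hmem : (d₁, d₂) ∈ Finset.antidiagonal (d₁ + d₂) := Finset.mem_antidiagonal.2 rfl
  exact Finset.single_le_sum (s := Finset.antidiagonal (d₁ + d₂))
    (f := fun x : (σ →₀ ℕ) × (σ →₀ ℕ) => coeff x.1 g * coeff x.2 h)
    (fun x _ => mul_nonneg (hg x.1) (hh x.2)) hmem

/-- A nonzero coefficient of a cancellation-free sum of products is witnessed by one term and one
splitting with both factors' coefficients positive. [folklore] -/
theorem exists_split_of_coeff_sum_mul_ne_zero {r : ℕ} {g h : Fin r → MvPolynomial σ ℝ}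
    (hg : ∀ k d, 0 ≤ coeff d (g k)) (hh : ∀ k d, 0 ≤ coeff d (h k)) {e : σ →₀ ℕ}
    (he : coeff e (∑ k, g k * h k) ≠ 0) :
    ∃ (k : Fin r) (d₁ d₂ : σ →₀ ℕ), d₁ + d₂ = e ∧ 0 < coeff d₁ (g k) ∧ 0 < coeff d₂ (h k) := by
  classical
  rw [coeff_sum] at he
  obtain ⟨k, -, hk⟩ := Finset.exists_ne_zero_of_sum_ne_zero he
  rw [coeff_mul] at hk
  obtain ⟨x, hx, hxne⟩ := Finset.exists_ne_zero_of_sum_ne_zero hk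
  refine ⟨k, x.1, x.2, Finset.mem_antidiagonal.1 hx, ?_, ?_⟩
  · exact (hg k x.1).lt_of_ne fun h0 => hxne (by rw [← h0, zero_mul])
  · exact (hh k x.2).lt_of_ne fun h0 => hxne (by rw [← h0, mul_zero])

end Monotone

/-! ### §3 The set-stabiliser count -/

/-- The permutations of `Fin m` stabilising a set `S` of cardinality `a` number `(m - a)! · a!`
(`DomMulAct.stabilizer_card` for the indicator function of `S`). [folklore] -/
theorem card_setStabilizer {m : ℕ} (S : Finset (Fin m)) :
    Fintype.card {g : Equiv.Perm (Fin m) // (fun c => decide (c ∈ S)) ∘ g = fun c => decide (c ∈ S)}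
      = (m - S.card).factorial * S.card.factorial := by
  rw [DomMulAct.stabilizer_card, Fintype.prod_bool]
  have ht : Fintype.card {c : Fin m // decide (c ∈ S) = true} = S.card := by
    rw [Fintype.card_subtype]
    congr 1
    ext c
    simp
  have hf : Fintype.card {c : Fin m // decide (c ∈ S) = false} = m - S.card := by
    rw [Fintype.card_subtype]
    have : (Finset.univ.filter fun c : Fin m => decide (c ∈ S) = false) = Sᶜ := by
      ext c
      simp
    rw [this, Finset.card_compl, Fintype.card_fin]
  rw [ht, hf, mul_comm]


/-! ### §4 The calibration -/

/-- **Stub `stub_monotoneCalibration`** (line `one-cut-strength` of crux `DetQP.DetqpThesis`,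
stmt-ValiantsHypothesis-0315; registered signature verbatim): a cancellation-free
`(a, n-a)`-decomposition of the real permanent — `per_n = Σ_{k<r} g_k h_k`, `g_k` homogeneous of
degree `a`, `h_k` of degree `n - a`, all coefficients nonnegative — has `r ≥ C(n, a)` terms. -/
theorem stub_monotoneCalibration : ∀ n a r : ℕ, a ≤ n →
    ∀ g h : Fin r → MvPolynomial (Fin n × Fin n) ℝ,
      (∀ k d, 0 ≤ coeff d (g k)) → (∀ k d, 0 ≤ coeff d (h k)) →
      (∀ k, (g k).IsHomogeneous a) → (∀ k, (h k).IsHomogeneous (n - a)) →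
      perPoly (Fin n) ℝ = ∑ k, g k * h k → n.choose a ≤ r := by
  intro n a r ha g h hg hh hgH _hhH hper
  classical
  -- Step 1: every permutation monomial is split by some term, cancellation-free.
  have hsplit : ∀ ρ : Equiv.Perm (Fin n), ∃ (k : Fin r) (d : (Fin n × Fin n) →₀ ℕ),
      d ≤ permMonomial ρ ∧ 0 < coeff d (g k) ∧ 0 < coeff (permMonomial ρ - d) (h k) := by
    intro ρ
    have hne : coeff (permMonomial ρ) (∑ k, g k * h k) ≠ 0 := by
      rw [← hper, coeff_permMonomial_perPoly]; exact one_ne_zero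
    obtain ⟨k, d₁, d₂, hsum, h1, h2⟩ := exists_split_of_coeff_sum_mul_ne_zero hg hh hne
    have hle : d₁ ≤ permMonomial ρ := hsum ▸ le_self_add
    refine ⟨k, d₁, hle, h1, ?_⟩
    have : permMonomial ρ - d₁ = d₂ := by rw [← hsum, add_tsub_cancel_left]
    rwa [this]
  choose κ δ hδle hδg hδh using hsplit
  -- Step 2: two permutations in the same fibre use the same columns and the same rows.
  have hcross : ∀ ρ ρ' : Equiv.Perm (Fin n), κ ρ = κ ρ' →
      ∃ τ : Equiv.Perm (Fin n), δ ρ + (permMonomial ρ' - δ ρ') = permMonomial τ := by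
    intro ρ ρ' hk
    have h1 : 0 < coeff (δ ρ + (permMonomial ρ' - δ ρ')) (g (κ ρ) * h (κ ρ)) := by
      refine lt_of_lt_of_le (mul_pos (hδg ρ) ?_) (coeff_mul_coeff_le_coeff_mul (hg _) (hh _) _ _)
      rw [hk]; exact hδh ρ'
    have h2 : coeff (δ ρ + (permMonomial ρ' - δ ρ')) (g (κ ρ) * h (κ ρ)) ≤
        coeff (δ ρ + (permMonomial ρ' - δ ρ')) (perPoly (Fin n) ℝ) := by
      rw [hper, coeff_sum]
      exact Finset.single_le_sum (f := fun k => coeff (δ ρ + (permMonomial ρ' - δ ρ')) (g k * h k))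
        (fun k _ => coeff_mul_nonneg (hg k) (hh k) _) (Finset.mem_univ _)
    obtain ⟨τ, hτ⟩ := exists_permMonomial_eq_of_coeff_perPoly_ne_zero ℝ (h1.trans_le h2).ne'
    exact ⟨τ, hτ.symm⟩
  have hcol : ∀ ρ ρ' : Equiv.Perm (Fin n), κ ρ = κ ρ' → ∀ c,
      (δ ρ (ρ c, c) ≠ 0 ↔ δ ρ' (ρ' c, c) ≠ 0) := by
    intro ρ ρ' hk c
    obtain ⟨τ, hτ⟩ := hcross ρ ρ' hk
    exact col_iff_of_cross (hδle ρ) (hδle ρ') hτ c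
  have hrow : ∀ ρ ρ' : Equiv.Perm (Fin n), κ ρ = κ ρ' → ∀ rr,
      (δ ρ (rr, ρ.symm rr) ≠ 0 ↔ δ ρ' (rr, ρ'.symm rr) ≠ 0) := by
    intro ρ ρ' hk rr
    obtain ⟨τ, hτ⟩ := hcross ρ ρ' hk
    exact row_iff_of_cross (hδle ρ) (hδle ρ') hτ rr
  -- the column set of `ρ` and its cardinality `a`
  set S : Equiv.Perm (Fin n) → Finset (Fin n) := fun ρ => Finset.univ.filter fun c => δ ρ (ρ c, c) ≠ 0
    with hS
  have hScard : ∀ ρ, (S ρ).card = a := by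
    intro ρ
    rw [hS, card_colSet_of_le_permMonomial (hδle ρ)]
    have hw := hgH (κ ρ) (hδg ρ).ne'
    rw [Finsupp.degree_eq_weight_one]
    exact hw
  -- Step 3: each fibre injects into a set-stabiliser.
  have hfibre : ∀ k : Fin r,
      (Finset.univ.filter fun ρ : Equiv.Perm (Fin n) => κ ρ = k).card ≤ (n - a).factorial * a.factorial := by
    intro k
    by_cases hk : ∃ ρ₀ : Equiv.Perm (Fin n), κ ρ₀ = k
    · obtain ⟨ρ₀, hρ₀⟩ := hk
      rw [← hScard ρ₀, ← card_setStabilizer (S ρ₀), Fintype.card_subtype]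
      refine Finset.card_le_card_of_injOn (fun ρ => ρ₀⁻¹ * ρ) (fun ρ hρ => ?_) ?_
      · rw [Finset.coe_filter, Set.mem_setOf_eq] at hρ ⊢
        refine ⟨Finset.mem_univ _, ?_⟩
        have hk' : κ ρ = κ ρ₀ := hρ.2.trans hρ₀.symm
        funext c
        simp only [Function.comp_apply, Equiv.Perm.coe_mul, hS, Finset.mem_filter, Finset.mem_univ,
          true_and]
        -- `ρ₀⁻¹ (ρ c) ∈ S ρ₀ ↔ c ∈ S ρ₀`
        have e1 : δ ρ₀ (ρ₀ (ρ₀⁻¹ (ρ c)), ρ₀⁻¹ (ρ c)) ≠ 0 ↔ δ ρ (ρ c, ρ.symm (ρ c)) ≠ 0 := by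
          rw [Equiv.Perm.coe_inv, Equiv.apply_symm_apply]
          exact (hrow ρ ρ₀ hk' (ρ c)).symm
        have e2 : δ ρ (ρ c, ρ.symm (ρ c)) ≠ 0 ↔ δ ρ₀ (ρ₀ c, c) ≠ 0 := by
          rw [Equiv.symm_apply_apply]
          exact hcol ρ ρ₀ hk' c
        simp only [e1.trans e2]
      · intro ρ _ ρ' _ hρρ'
        exact mul_left_cancel hρρ'
    · rw [Finset.filter_eq_empty_iff.2 fun ρ _ hρ => hk ⟨ρ, hρ⟩, Finset.card_empty]
      exact Nat.zero_le _
  -- Step 4: count.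
  have hcount : n.factorial ≤ r * ((n - a).factorial * a.factorial) := by
    calc n.factorial = Fintype.card (Equiv.Perm (Fin n)) := by
          rw [Fintype.card_perm, Fintype.card_fin]
      _ = (Finset.univ : Finset (Equiv.Perm (Fin n))).card := Finset.card_univ.symm
      _ = ∑ k : Fin r, (Finset.univ.filter fun ρ : Equiv.Perm (Fin n) => κ ρ = k).card :=
          Finset.card_eq_sum_card_fiberwise (fun ρ _ => Finset.mem_univ (κ ρ))
      _ ≤ ∑ _k : Fin r, (n - a).factorial * a.factorial := Finset.sum_le_sum fun k _ => hfibre k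
      _ = r * ((n - a).factorial * a.factorial) := by
          rw [Finset.sum_const, Finset.card_univ, Fintype.card_fin, smul_eq_mul]
  have hfact : n.factorial = n.choose a * ((n - a).factorial * a.factorial) := by
    rw [← Nat.choose_mul_factorial_mul_factorial ha]; ring
  rw [hfact] at hcount
  exact Nat.le_of_mul_le_mul_right hcount (by positivity)

end Summit.ValiantsHypothesis.ValiantsHypothesis.Theorems.DetqpThesis.OneCutStrength

end
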